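import Literature.AnabelianGeometry.EtaleTheta.KummerKernel
import Mathlib.CategoryTheory.CofilteredSystem
import Mathlib.Data.Nat.Factorial.Basic

/-!
# Compatible systems of roots from finiteness of torsion (König), and the Kummer-injectivity criterion

Companion to `EtaleTheta/Cyclotome.lean` (compatible root systems `RootSystem a`,
[cite: LANA2026Report, §6.1 p.31]) and `EtaleTheta/KummerKernel.lean` (the kernel of the Kummer map).
In a commutative group whose `n`-torsion is FINITE for every `n ≥ 1` (e.g. the multiplicative group of
a field), an element that admits an `n`-th root for every `n` admits a COMPATIBLE system of roots:
the sets of `k!`-th roots form an inverse system of nonempty finite sets, whose limit is nonempty by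
König's lemma (Mathlib `nonempty_sections_of_finite_inverse_system`), and a thread `(c_k)` with
`c_{k+1}^{k+1} = c_k` yields the root system `x_n := c_n ^ (n!/n)` (the device of
`RootSystem.ofRootableBy`). Consequences:

* `RootSystem.nonempty_of_finite_torsion` — the existence statement;
* `kummerMapFixed_injective_iff_of_finite_torsion` — for `A^H` with finite torsion, the Kummer map
  `A^H → H¹(H, Λ(A))` is injective **iff** `⋂_N (A^H)^N = 1` (no nontrivial element of `A^H` has `n`-th
  roots in `A^H` for all `n`): the equivalence "(a) ⟺ (b)" of [AbsTopIII] Def. 1.5 (Kummer-faithful)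
  in abstract form, completing `kummerMapFixed_injective_of_iInter_pow_eq_bot` of `KummerKernel.lean`.

Everything is proved. Universe `Type` for the cohomological statement (Mathlib `groupCohomology`).
-/

namespace Literature.AnabelianGeometry.EtaleTheta

open CategoryTheory

universe u

namespace RootSystem

section Existence

variable {A : Type u} [CommGroup A]

/-- The `m`-th roots of a fixed element form a finite set as soon as the `m`-torsion is finite (they
are empty or a torsor under the `m`-torsion). [folklore] -/
private theorem finite_setOf_pow_eq (m : ℕ) (hfin : Set.Finite {x : A | x ^ m = 1}) (a : A) :
    Set.Finite {x : A | x ^ m = a} := by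
  by_cases hne : ∃ x₀ : A, x₀ ^ m = a
  · obtain ⟨x₀, hx₀⟩ := hne
    refine (hfin.image fun t => x₀ * t).subset ?_
    intro x hx
    refine ⟨x / x₀, ?_, ?_⟩
    · change (x / x₀) ^ m = 1
      rw [div_pow, hx₀]
      exact div_eq_one.2 hx
    · change x₀ * (x / x₀) = x
      exact mul_div_cancel x₀ x
  · exact Set.Finite.subset Set.finite_empty fun x hx => (hne ⟨x, hx⟩).elim

/-- Exponent bookkeeping: `l!/k! · k!/j! = l!/j!` for `j ≤ k ≤ l`. [folklore] -/
private theorem factorial_div_mul_div {j k l : ℕ} (hjk : j ≤ k) (hkl : k ≤ l) :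
    l.factorial / k.factorial * (k.factorial / j.factorial) = l.factorial / j.factorial := by
  have h1 := Nat.factorial_dvd_factorial hjk
  have h2 := Nat.factorial_dvd_factorial hkl
  refine Nat.eq_of_mul_eq_mul_right (Nat.factorial_pos j) ?_
  rw [mul_assoc, Nat.div_mul_cancel h1, Nat.div_mul_cancel h2, Nat.div_mul_cancel (h1.trans h2)]

/-- Exponent bookkeeping: `(nm)!/(nm) · m = ((nm)!/n!) · (n!/n)` (both are `(nm)!/n`). [folklore] -/
private theorem factorial_exponent_identity {n m : ℕ} (hn : 0 < n) (hm : 0 < m) :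
    (n * m).factorial / (n * m) * m = (n * m).factorial / n.factorial * (n.factorial / n) := by
  have h1 : n.factorial ∣ (n * m).factorial :=
    Nat.factorial_dvd_factorial (Nat.le_mul_of_pos_right _ hm)
  have h2 : n ∣ n.factorial := Nat.dvd_factorial hn le_rfl
  have h3 : n * m ∣ (n * m).factorial := Nat.dvd_factorial (Nat.mul_pos hn hm) le_rfl
  rw [← Nat.div_div_eq_div_mul, Nat.div_mul_cancel (Nat.dvd_div_of_mul_dvd h3),
    ← Nat.mul_div_assoc _ h2, Nat.div_mul_cancel h1]

/-- The inverse system `k ↦ {x | x ^ k! = a}` with transition maps `x ↦ x ^ (l!/k!)`. [folklore] -/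
private def factorialRoots (a : A) : ℕᵒᵖ ⥤ Type u where
  obj k := {x : A // x ^ (Opposite.unop k).factorial = a}
  map {l k} f := TypeCat.ofHom fun x =>
    ⟨x.1 ^ ((Opposite.unop l).factorial / (Opposite.unop k).factorial), by
      rw [← pow_mul, Nat.div_mul_cancel (Nat.factorial_dvd_factorial f.unop.le), x.2]⟩
  map_id k := ConcreteCategory.hom_ext _ _ fun x => Subtype.ext (by
    change x.1 ^ (_ / _) = x.1
    rw [Nat.div_self (Nat.factorial_pos _), pow_one])
  map_comp {l k j} f g := ConcreteCategory.hom_ext _ _ fun x => Subtype.ext (by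
    change x.1 ^ (_ / _) = (x.1 ^ (_ / _)) ^ (_ / _)
    rw [← pow_mul, factorial_div_mul_div g.unop.le f.unop.le])

/-- **Compatible roots from finite torsion (König).** If every `n`-torsion subgroup of `A` (`n ≥ 1`)
is finite and `a` has an `n`-th root for every `n ≥ 1`, then `a` admits a compatible system of roots
(the converse implication "compatible system ⇒ roots of all orders" being trivial). The finiteness
makes the sets of `k!`-th roots an inverse system of nonempty FINITE sets, which has a thread by
`nonempty_sections_of_finite_inverse_system`. [cite: LANA2026Report, §6.1 p.31] -/
theorem nonempty_of_finite_torsion {a : A}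
    (hfin : ∀ n : ℕ+, Set.Finite {x : A | x ^ (n : ℕ) = 1})
    (ha : ∀ n : ℕ+, ∃ b : A, b ^ (n : ℕ) = a) : Nonempty (RootSystem a) := by
  haveI : ∀ k : ℕᵒᵖ, Finite ((factorialRoots a).obj k) := fun k =>
    (finite_setOf_pow_eq _
      (hfin ⟨(Opposite.unop k).factorial, Nat.factorial_pos _⟩) a).to_subtype
  haveI : ∀ k : ℕᵒᵖ, Nonempty ((factorialRoots a).obj k) := fun k => by
    obtain ⟨b, hb⟩ := ha ⟨(Opposite.unop k).factorial, Nat.factorial_pos _⟩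
    exact ⟨⟨b, hb⟩⟩
  obtain ⟨s, hs⟩ := nonempty_sections_of_finite_inverse_system (factorialRoots a)
  -- the thread: `c k := s (op k)` with `c k ^ k! = a` and `c l ^ (l!/k!) = c k` for `k ≤ l`
  have hc : ∀ {k l : ℕ} (hkl : k ≤ l),
      (s (Opposite.op l)).1 ^ (l.factorial / k.factorial) = (s (Opposite.op k)).1 :=
    fun {k l} hkl => by
      have e := congrArg Subtype.val (hs (homOfLE hkl).op)
      exact e
  refine ⟨{ root := fun n => (s (Opposite.op (n : ℕ))).1 ^ ((n : ℕ).factorial / (n : ℕ))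
            root_one := ?_
            root_mul_pow := fun n m => ?_ }⟩
  · have h1 := (s (Opposite.op ((1 : ℕ+) : ℕ))).2
    change (s (Opposite.op 1)).1 ^ (Nat.factorial 1) = a at h1
    change (s (Opposite.op 1)).1 ^ (Nat.factorial 1 / 1) = a
    rwa [Nat.div_one]
  · have hle : (n : ℕ) ≤ (n : ℕ) * m := Nat.le_mul_of_pos_right _ m.pos
    change ((s (Opposite.op ((n : ℕ) * m))).1 ^ (((n : ℕ) * m).factorial / ((n : ℕ) * m))) ^ (m : ℕ)
      = (s (Opposite.op (n : ℕ))).1 ^ ((n : ℕ).factorial / (n : ℕ))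
    rw [← hc hle, ← pow_mul, ← pow_mul, factorial_exponent_identity n.pos m.pos]

end Existence

end RootSystem

/-! ### The Kummer-injectivity criterion under finite torsion -/

section Kummer

variable {G : Type} [Group G] {A : Type} [CommGroup A] [MulDistribMulAction G A]
  (H : Subgroup G) [RootableBy A ℕ]

/-- **[AbsTopIII] Def. 1.5, (a) ⟺ (b), abstract form.** If the invariants `A^H` have finite `n`-torsion
for every `n ≥ 1`, then the Kummer map `A^H → H¹(H, Λ(A))` ([cite: LANA2026Report, §6.1 p.31]) is
injective iff no `a ≠ 1` in `A^H` admits an `n`-th root in `A^H` for every `n ≥ 1`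
("`⋂_{N ≥ 1} N · A = 0`"). (⇐) is `kummerMapFixed_injective_of_iInter_pow_eq_bot`; (⇒): such roots
assemble into an `H`-invariant compatible root system (`RootSystem.nonempty_of_finite_torsion` in the
group `A^H`), whose Kummer class vanishes (`kummerClass_eq_zero_iff`). -/
theorem kummerMapFixed_injective_iff_of_finite_torsion
    (hfin : ∀ n : ℕ+, Set.Finite {x : invariants (A := A) H | x ^ (n : ℕ) = 1}) :
    Function.Injective (kummerMapFixed (A := A) H) ↔
      ∀ a : invariants (A := A) H,
        (∀ n : ℕ+, ∃ b : invariants (A := A) H, b ^ (n : ℕ) = a) → a = 1 := by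
  refine ⟨fun hinj a ha => ?_, kummerMapFixed_injective_of_iInter_pow_eq_bot H⟩
  obtain ⟨y⟩ := RootSystem.nonempty_of_finite_torsion hfin ha
  -- `y` is a compatible root system of `a` INSIDE `A^H`; read in `A` it is `H`-invariant
  have hy : (y.map (invariants (A := A) H).subtype).IsInvariant H :=
    fun n h => (y.root n).2 h
  have h0 : kummerClass H a = 0 :=
    (kummerClass_eq_zero_iff H a).2 ⟨y.map (invariants (A := A) H).subtype, hy⟩
  have h1 : kummerMapFixed H (Additive.ofMul a) = kummerMapFixed H 0 := by
    rw [kummerMapFixed_apply, h0, map_zero]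
  exact Additive.ofMul.injective ((hinj h1).trans ofMul_one.symm)

end Kummer

end Literature.AnabelianGeometry.EtaleTheta
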